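import Literature.AlgebraicGeometry.Motives.MixedHodgeStructureMultiplicityFormulas
import HarnessLib

/-!
# Semisimple mixed Hodge structures are classified by their multiplicities

Sequel to `MixedHodgeStructureCompositionMultiplicity` / `…MultiplicityFormulas` (the Jordan–Hölder multiplicity
`[H : S] = H.multiplicity S`, additive on direct sums, `[H : S] = [Gr^W_m H : S]` for `S` pure of weight `m`) and
`MixedHodgeStructureSemisimple{,Sums}` (semisimple MHS: every sub-MHS is a direct summand; a semisimple MHS is a
sum of simple sub-MHS). Adkins–Weintraub, *Algebra*, Ch. 7, §1: a semisimple module has a *simple factorization*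
`M ≅ ⊕_α Γ_α M_α` into its distinct simple constituents `M_α` ((1.3)–(1.4), p. 401), and **Thm. 7.1.18** (p. 402):
if `M ≅ N` are semisimple with simple factorizations `⊕_α Γ_α M_α`, `⊕_β Λ_β N_β`, there is a bijection `ψ` with
`M_α ≅ N_{ψ(α)}` and `|Γ_α| = |Λ_{ψ(α)}|` — i.e. the multiplicities `|Γ_α| = [M : M_α]` are isomorphism invariants
and, conversely (the factorization being determined by them), **two semisimple modules of finite length with the
same multiplicities of every simple module are isomorphic**. For the abelian category of mixed Hodge structures
(Cattani–El Zein–Griffiths–Lê, Thm. 3.2.18; semisimple MHS, Ch. 12 footnote 2) this file proves: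

* §1 **the simple constituents of a semisimple `H` are the simple `S` with `[H : S] > 0`**: such an `S` is
  isomorphic to a sub-MHS (= direct summand) of `H` (`IsSemisimple.exists_sub_iso_of_multiplicity_pos`),
  equivalently `S` embeds into `H` (`IsSemisimple.multiplicity_pos_iff_exists_injective`).
* §2 **classification: semisimple `H`, `H'` with `[H : S] = [H' : S]` for all simple `S` are isomorphic**
  (`IsSemisimple.exists_hom_bijective_of_multiplicity_eq`, by splitting off a common simple summand and induction
  on the dimension, the summand isomorphisms glued along `H = S₀ ⊕ T`), and the `iff` form
  (`IsSemisimple.iso_iff_forall_multiplicity_eq`; the direction "isomorphic ⟹ same multiplicities" is the tree's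
  `multiplicity_eq_of_bijective`).
* §3 consequences for the weight filtration: MHS with isomorphic graded pieces `Gr^W_k H ≅ Gr^W_k H'` have the same
  multiplicities (`multiplicity_eq_of_forall_gr_iso`), and **for graded-polarizable `H`, `H'` (semisimple `Gr^W_k`)
  the converse holds: `[H : S] = [H' : S]` for all simple `S` iff `Gr^W_k H ≅ Gr^W_k H'` for all `k`**
  (`IsGradedPolarizable.forall_gr_iso_iff_forall_multiplicity_eq`) — the composition factors of a graded-polarizable
  MHS record exactly its pure graded pieces and nothing of the extension data; `ℚ`-split graded-polarizable MHS and
  polarizable pure Hodge structures are classified by their multiplicities.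

All statements proved; no definitions, no named facts, no instances.

## References

* [AdkinsWeintraub1992] W. A. Adkins, S. H. Weintraub, Algebra — An Approach via Module Theory, GTM 136 (1992),
  Ch. 7, §1, (1.3)–(1.4) p. 401, Thm. 1.18 and Cor. 1.19 pp. 402–403 (held text `book:adkins1992-algebra`,
  chunks p0378–p0380).
* [Beachy1999RingsModules] J. A. Beachy, Introductory Lectures on Rings and Modules (1999), §2.5, Thm. 2.5.2.
* [CattaniElZeinGriffithsLe2014] E. Cattani et al. (eds.), Hodge Theory (2014), Thm. 3.2.18, p. 270,
  Ch. 12 footnote 2 (p. 527).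
* [Jannsen1990MixedMotives] U. Jannsen, Mixed Motives and Algebraic K-Theory, LNM 1400 (1990), Thm. 7.9 (proof).
-/

noncomputable section

namespace Literature.AlgebraicGeometry.Motives

namespace MixedHodgeStructure

open Module SubMixedHodgeStructure

universe u w

section IsoHelpers

variable {W₁ : Type*} [AddCommGroup W₁] [Module ℚ W₁] {G₁ : MixedHodgeStructure W₁}
variable {W₂ : Type*} [AddCommGroup W₂] [Module ℚ W₂] {G₂ : MixedHodgeStructure W₂}
variable {W₃ : Type*} [AddCommGroup W₃] [Module ℚ W₃] {G₃ : MixedHodgeStructure W₃}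

/-- "Isomorphic" is symmetric. [cite: CattaniElZeinGriffithsLe2014, Thm. 3.2.18] -/
private theorem iso_symm (h : ∃ e : Hom G₁ G₂, Function.Bijective e.toLinearMap) :
    ∃ e : Hom G₂ G₁, Function.Bijective e.toLinearMap := by
  obtain ⟨e, he⟩ := h
  refine ⟨e.inverse he, ?_⟩
  rw [Hom.inverse_toLinearMap]
  exact (LinearEquiv.ofBijective e.toLinearMap he).symm.bijective

/-- "Isomorphic" is transitive. [cite: CattaniElZeinGriffithsLe2014, Thm. 3.2.18] -/
private theorem iso_trans (h₁ : ∃ e : Hom G₁ G₂, Function.Bijective e.toLinearMap)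
    (h₂ : ∃ e : Hom G₂ G₃, Function.Bijective e.toLinearMap) :
    ∃ e : Hom G₁ G₃, Function.Bijective e.toLinearMap := by
  obtain ⟨e₁, he₁⟩ := h₁
  obtain ⟨e₂, he₂⟩ := h₂
  refine ⟨e₂.comp e₁, ?_⟩
  rw [Hom.comp_toLinearMap, LinearMap.coe_comp]
  exact he₂.comp he₁

end IsoHelpers

variable {V : Type u} [AddCommGroup V] [Module ℚ V] {H : MixedHodgeStructure V}
variable {V' : Type u} [AddCommGroup V'] [Module ℚ V'] {H' : MixedHodgeStructure V'}
variable {U : Type w} [AddCommGroup U] [Module ℚ U] {S : MixedHodgeStructure U}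

/-! ### §1 The simple constituents of a semisimple MHS -/

/-- `[H : S] > 0` whenever `S` is isomorphic to a simple sub-MHS of `H`. [cite: Beachy1999RingsModules, §2.5, Def. 2.5.1]
[cite: AdkinsWeintraub1992, Ch. 7, §1, (1.4)] -/
theorem multiplicity_pos_of_sub_iso [FiniteDimensional ℚ V] (hS : S.IsSimple) (T : SubMixedHodgeStructure H)
    (e : Hom T.toMixedHodgeStructure S) (he : Function.Bijective e.toLinearMap) : 0 < H.multiplicity S := by
  rw [← multiplicity_congr H e he]
  exact T.one_le_multiplicity_of_isSimple ((isSimple_iff_of_bijective e he).2 hS)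

/-- The auxiliary induction on `dim V` for `IsSemisimple.exists_sub_iso_of_multiplicity_pos`.
[cite: AdkinsWeintraub1992, Ch. 7, §1, Thm. 1.18 (proof)] -/
private theorem exists_sub_iso_aux (d : ℕ) : ∀ {W : Type u} [AddCommGroup W] [Module ℚ W] [FiniteDimensional ℚ W]
    (K : MixedHodgeStructure W), finrank ℚ W ≤ d → K.IsSemisimple →
    ∀ {U : Type w} [AddCommGroup U] [Module ℚ U] (S : MixedHodgeStructure U), 0 < K.multiplicity S →
    ∃ T : SubMixedHodgeStructure K, ∃ e : Hom T.toMixedHodgeStructure S, Function.Bijective e.toLinearMap := by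
  induction d with
  | zero =>
    intro W _ _ _ K hd _ U _ _ S hS
    haveI : Subsingleton W := finrank_zero_iff.1 (Nat.le_zero.1 hd)
    rw [multiplicity_eq_zero_of_subsingleton] at hS
    exact absurd hS (lt_irrefl 0)
  | succ d ih =>
    intro W _ _ _ K hd hK U _ _ S hS
    by_cases hW : Subsingleton W
    · rw [multiplicity_eq_zero_of_subsingleton] at hS
      exact absurd hS (lt_irrefl 0)
    rw [not_subsingleton_iff_nontrivial] at hW
    -- split off a simple summand `K = S₀ ⊕ T`
    obtain ⟨S₀, hS₀⟩ := K.exists_subMixedHodgeStructure_isSimple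
    obtain ⟨T, hT⟩ := hK S₀
    rw [multiplicity_eq_add_of_isCompl S₀ T hT S] at hS
    by_cases h₀ : 0 < S₀.toMixedHodgeStructure.multiplicity S
    · -- `[S₀ : S] > 0` forces `S₀ ≅ S`
      classical
      rw [hS₀.multiplicity_eq S] at h₀
      split_ifs at h₀ with he
      · exact ⟨S₀, he⟩
      · exact absurd h₀ (lt_irrefl 0)
    · -- otherwise `S` is a constituent of the smaller semisimple complement `T`
      have hT' : 0 < T.toMixedHodgeStructure.multiplicity S := by omega
      haveI := hS₀.nontrivial
      have hdim : finrank ℚ T.toSubmodule ≤ d := by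
        have h1 := Submodule.finrank_add_eq_of_isCompl hT
        have h2 : 0 < finrank ℚ S₀.toSubmodule := finrank_pos
        omega
      obtain ⟨R, e, he⟩ := ih T.toMixedHodgeStructure hdim (hK.subMixedHodgeStructure T) S hT'
      obtain ⟨f, hf⟩ := T.exists_hom_ofSub_bijective R
      exact ⟨T.ofSub R, iso_trans (iso_symm ⟨f, hf⟩) ⟨e, he⟩⟩

/-- **Every composition factor of a semisimple MHS is (isomorphic to) a sub-MHS, hence a direct summand**: if `H` is
semisimple and `[H : S] > 0` then `S ≅ T` for some sub-MHS `T ⊆ H`. [cite: AdkinsWeintraub1992, Ch. 7, §1, (1.3)–(1.4) and Thm. 1.18]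
[cite: CattaniElZeinGriffithsLe2014, Ch. 12 footnote 2 (p. 527)] -/
theorem IsSemisimple.exists_sub_iso_of_multiplicity_pos [FiniteDimensional ℚ V] (hH : H.IsSemisimple)
    (hS : 0 < H.multiplicity S) :
    ∃ T : SubMixedHodgeStructure H, ∃ e : Hom T.toMixedHodgeStructure S, Function.Bijective e.toLinearMap :=
  exists_sub_iso_aux (finrank ℚ V) H le_rfl hH S hS

/-- For semisimple `H` and simple `S`: **`[H : S] > 0` iff `S` is isomorphic to a sub-MHS of `H`.**
[cite: AdkinsWeintraub1992, Ch. 7, §1, (1.4) and Thm. 1.18] [cite: Beachy1999RingsModules, §2.5, Def. 2.5.1] -/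
theorem IsSemisimple.multiplicity_pos_iff_exists_sub_iso [FiniteDimensional ℚ V] (hH : H.IsSemisimple) (hS : S.IsSimple) :
    0 < H.multiplicity S ↔
      ∃ T : SubMixedHodgeStructure H, ∃ e : Hom T.toMixedHodgeStructure S, Function.Bijective e.toLinearMap :=
  ⟨hH.exists_sub_iso_of_multiplicity_pos, fun ⟨T, e, he⟩ => multiplicity_pos_of_sub_iso hS T e he⟩

/-- For semisimple `H` and simple `S`: **`[H : S] > 0` iff `S` embeds into `H`.**
[cite: AdkinsWeintraub1992, Ch. 7, §1, Thm. 1.18 (proof)] [cite: CattaniElZeinGriffithsLe2014, Thm. 3.2.18] -/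
theorem IsSemisimple.multiplicity_pos_iff_exists_injective [FiniteDimensional ℚ V] (hH : H.IsSemisimple)
    (hS : S.IsSimple) : 0 < H.multiplicity S ↔ ∃ f : Hom S H, Function.Injective f.toLinearMap := by
  rw [hH.multiplicity_pos_iff_exists_sub_iso hS]
  constructor
  · rintro ⟨T, e, he⟩
    obtain ⟨e', he'⟩ := iso_symm ⟨e, he⟩
    refine ⟨T.subtype.comp e', ?_⟩
    rw [Hom.comp_toLinearMap, LinearMap.coe_comp]
    exact (Submodule.injective_subtype _).comp he'.1
  · rintro ⟨f, hf⟩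
    exact ⟨f.range, iso_symm ⟨f.rangeRestrict, f.rangeRestrict_bijective_of_injective hf⟩⟩

/-! ### §2 Classification of semisimple MHS by multiplicities -/

/-- Gluing summand isomorphisms: if `K = A ⊕ B`, `K' = A' ⊕ B'` with `A ≅ A'` and `B ≅ B'`, then `K ≅ K'`.
[cite: AdkinsWeintraub1992, Ch. 7, §1, Thm. 1.18 (proof)] [cite: CattaniElZeinGriffithsLe2014, Thm. 3.2.18] -/
private theorem glue {W : Type u} [AddCommGroup W] [Module ℚ W] {K : MixedHodgeStructure W}
    {W' : Type u} [AddCommGroup W'] [Module ℚ W'] {K' : MixedHodgeStructure W'}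
    (A B : SubMixedHodgeStructure K) (hAB : IsCompl A.toSubmodule B.toSubmodule)
    (A' B' : SubMixedHodgeStructure K') (hAB' : IsCompl A'.toSubmodule B'.toSubmodule)
    (hA : ∃ e : Hom A.toMixedHodgeStructure A'.toMixedHodgeStructure, Function.Bijective e.toLinearMap)
    (hB : ∃ e : Hom B.toMixedHodgeStructure B'.toMixedHodgeStructure, Function.Bijective e.toLinearMap) :
    ∃ e : Hom K K', Function.Bijective e.toLinearMap := by
  obtain ⟨eA, heA⟩ := hA
  obtain ⟨eB, heB⟩ := hB
  -- `K ≅ A ⊕ B` (external) and `A ⊕ B → K'`, `(a, b) ↦ eA a + eB b`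
  have h₁ : ∃ e : Hom K (A.toMixedHodgeStructure.prod B.toMixedHodgeStructure), Function.Bijective e.toLinearMap :=
    iso_symm ⟨Hom.coprodDesc A.subtype B.subtype, (Submodule.prodEquivOfIsCompl _ _ hAB).bijective⟩
  refine iso_trans h₁ ⟨Hom.coprodDesc (A'.subtype.comp eA) (B'.subtype.comp eB), ?_⟩
  have hfac : (Hom.coprodDesc (A'.subtype.comp eA) (B'.subtype.comp eB)).toLinearMap =
      (Hom.coprodDesc A'.subtype B'.subtype).toLinearMap ∘ₗ eA.toLinearMap.prodMap eB.toLinearMap := by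
    apply LinearMap.ext
    rintro ⟨a, b⟩
    simp only [Hom.coprodDesc_toLinearMap, Hom.comp_toLinearMap, LinearMap.coprod_apply, LinearMap.comp_apply,
      LinearMap.prodMap_apply]
  rw [hfac, LinearMap.coe_comp]
  refine (Submodule.prodEquivOfIsCompl _ _ hAB').bijective.comp ?_
  rw [LinearMap.coe_prodMap]
  exact heA.prodMap heB

/-- The zero case: a semisimple MHS with the multiplicities of `0` is `0`. [cite: AdkinsWeintraub1992, Ch. 7, §1, (1.4)] -/
private theorem iso_of_subsingleton {W : Type u} [AddCommGroup W] [Module ℚ W] [FiniteDimensional ℚ W] [Subsingleton W]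
    (K : MixedHodgeStructure W) {W' : Type u} [AddCommGroup W'] [Module ℚ W'] [FiniteDimensional ℚ W']
    (K' : MixedHodgeStructure W')
    (h : ∀ (U : Type u) [AddCommGroup U] [Module ℚ U] (S : MixedHodgeStructure U), S.IsSimple →
      K.multiplicity S = K'.multiplicity S) :
    ∃ e : Hom K K', Function.Bijective e.toLinearMap := by
  haveI : Subsingleton W' := by
    by_contra hW'
    rw [not_subsingleton_iff_nontrivial] at hW'
    obtain ⟨S', hS'⟩ := K'.exists_subMixedHodgeStructure_isSimple
    have h1 := S'.one_le_multiplicity_of_isSimple hS'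
    rw [← h _ S'.toMixedHodgeStructure hS', multiplicity_eq_zero_of_subsingleton] at h1
    exact Nat.not_succ_le_zero 0 h1
  exact ⟨Hom.zero K K', Function.injective_of_subsingleton _, fun y => ⟨0, Subsingleton.elim _ _⟩⟩

/-- The auxiliary induction on `dim V` for `IsSemisimple.exists_hom_bijective_of_multiplicity_eq`.
[cite: AdkinsWeintraub1992, Ch. 7, §1, Thm. 1.18 (proof)] -/
private theorem classify_aux (d : ℕ) : ∀ {W : Type u} [AddCommGroup W] [Module ℚ W] [FiniteDimensional ℚ W]
    (K : MixedHodgeStructure W) {W' : Type u} [AddCommGroup W'] [Module ℚ W'] [FiniteDimensional ℚ W']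
    (K' : MixedHodgeStructure W'), finrank ℚ W ≤ d → K.IsSemisimple → K'.IsSemisimple →
    (∀ (U : Type u) [AddCommGroup U] [Module ℚ U] (S : MixedHodgeStructure U), S.IsSimple →
      K.multiplicity S = K'.multiplicity S) → ∃ e : Hom K K', Function.Bijective e.toLinearMap := by
  induction d with
  | zero =>
    intro W _ _ _ K W' _ _ _ K' hd _ _ h
    haveI : Subsingleton W := finrank_zero_iff.1 (Nat.le_zero.1 hd)
    exact iso_of_subsingleton K K' h
  | succ d ih =>
    intro W _ _ _ K W' _ _ _ K' hd hK hK' h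
    by_cases hW : Subsingleton W
    · exact iso_of_subsingleton K K' h
    rw [not_subsingleton_iff_nontrivial] at hW
    -- split off a simple summand `K = S₀ ⊕ T`; `S₀` is a constituent of `K'` too: `K' = S₀' ⊕ T'` with `S₀' ≅ S₀`
    obtain ⟨S₀, hS₀⟩ := K.exists_subMixedHodgeStructure_isSimple
    obtain ⟨T, hT⟩ := hK S₀
    have hpos : 0 < K'.multiplicity S₀.toMixedHodgeStructure := by
      rw [← h _ S₀.toMixedHodgeStructure hS₀]
      exact S₀.one_le_multiplicity_of_isSimple hS₀
    obtain ⟨S₀', e₀, he₀⟩ := hK'.exists_sub_iso_of_multiplicity_pos hpos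
    obtain ⟨T', hT'⟩ := hK' S₀'
    -- the complements have the same multiplicities, hence are isomorphic by induction (`dim T < dim K`)
    have hmul : ∀ (U : Type u) [AddCommGroup U] [Module ℚ U] (S : MixedHodgeStructure U), S.IsSimple →
        T.toMixedHodgeStructure.multiplicity S = T'.toMixedHodgeStructure.multiplicity S := by
      intro U _ _ S hS
      have h1 := h U S hS
      rw [multiplicity_eq_add_of_isCompl S₀ T hT S, multiplicity_eq_add_of_isCompl S₀' T' hT' S,
        multiplicity_eq_of_bijective e₀ he₀ S] at h1
      omega
    haveI := hS₀.nontrivial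
    have hdim : finrank ℚ T.toSubmodule ≤ d := by
      have h1 := Submodule.finrank_add_eq_of_isCompl hT
      have h2 : 0 < finrank ℚ S₀.toSubmodule := finrank_pos
      omega
    have hTT' := ih T.toMixedHodgeStructure T'.toMixedHodgeStructure hdim (hK.subMixedHodgeStructure T)
      (hK'.subMixedHodgeStructure T') hmul
    exact glue S₀ T hT S₀' T' hT' (iso_symm ⟨e₀, he₀⟩) hTT'

/-- **Semisimple mixed Hodge structures are classified by their multiplicities** (Adkins–Weintraub, Thm. 7.1.18:
uniqueness of the simple factorization `⊕_α Γ_α M_α`, `|Γ_α| = [M : M_α]`): if `H`, `H'` are semisimple and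
`[H : S] = [H' : S]` for every simple MHS `S`, then `H ≅ H'`. [cite: AdkinsWeintraub1992, Ch. 7, §1, (1.4) and Thm. 1.18]
[cite: CattaniElZeinGriffithsLe2014, Thm. 3.2.18 and Ch. 12 footnote 2 (p. 527)] -/
theorem IsSemisimple.exists_hom_bijective_of_multiplicity_eq [FiniteDimensional ℚ V] [FiniteDimensional ℚ V']
    (hH : H.IsSemisimple) (hH' : H'.IsSemisimple)
    (h : ∀ (U : Type u) [AddCommGroup U] [Module ℚ U] (S : MixedHodgeStructure U), S.IsSimple →
      H.multiplicity S = H'.multiplicity S) :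
    ∃ e : Hom H H', Function.Bijective e.toLinearMap :=
  classify_aux (finrank ℚ V) H H' le_rfl hH hH' h

/-- **Two semisimple MHS are isomorphic iff they have the same multiplicities** `[H : S] = [H' : S]` (all `S`;
"⟹" is `multiplicity_eq_of_bijective`). [cite: AdkinsWeintraub1992, Ch. 7, §1, Thm. 1.18 and Cor. 1.19]
[cite: Beachy1999RingsModules, §2.5, Thm. 2.5.2] [cite: CattaniElZeinGriffithsLe2014, Thm. 3.2.18] -/
theorem IsSemisimple.iso_iff_forall_multiplicity_eq [FiniteDimensional ℚ V] [FiniteDimensional ℚ V']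
    (hH : H.IsSemisimple) (hH' : H'.IsSemisimple) :
    (∃ e : Hom H H', Function.Bijective e.toLinearMap) ↔
      ∀ (U : Type u) [AddCommGroup U] [Module ℚ U] (S : MixedHodgeStructure U), H.multiplicity S = H'.multiplicity S :=
  ⟨fun ⟨e, he⟩ _ _ _ S => multiplicity_eq_of_bijective e he S,
    fun h => hH.exists_hom_bijective_of_multiplicity_eq hH' fun U _ _ S _ => h U S⟩

/-! ### §3 Multiplicities and the graded pieces `Gr^W_k` -/

/-- **MHS with isomorphic graded pieces have the same multiplicities**: if `Gr^W_k H ≅ Gr^W_k H'` for all `k` then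
`[H : S] = [H' : S]` for all `S` (as `[H : S] = [Gr^W_m H : S]` for `S` simple of weight `m`).
[cite: Beachy1999RingsModules, §2.5, Thm. 2.5.2] [cite: CattaniElZeinGriffithsLe2014, Def. 3.2.15, Thm. 3.2.18 and Ex. 3.2.23 (1)] -/
theorem multiplicity_eq_of_forall_gr_iso [FiniteDimensional ℚ V] [FiniteDimensional ℚ V']
    (hgr : ∀ k, ∃ e : Hom (H.gr k).toMixedHodgeStructure (H'.gr k).toMixedHodgeStructure, Function.Bijective e.toLinearMap)
    (S : MixedHodgeStructure U) : H.multiplicity S = H'.multiplicity S := by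
  by_cases hS : S.IsSimple
  · haveI := hS.nontrivial
    obtain ⟨m, hm⟩ := hS.exists_isPure
    obtain ⟨e, he⟩ := hgr m
    rw [multiplicity_eq_multiplicity_gr H hm, multiplicity_eq_multiplicity_gr H' hm, multiplicity_eq_of_bijective e he S]
  · rw [multiplicity_eq_zero_of_not_isSimple H hS, multiplicity_eq_zero_of_not_isSimple H' hS]

/-- The graded pieces of two MHS with the same multiplicities have the same multiplicities:
`[Gr^W_k H : S] = [Gr^W_k H' : S]`. [cite: CattaniElZeinGriffithsLe2014, Def. 3.2.15 and Ex. 3.2.23 (1)]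
[cite: Beachy1999RingsModules, §2.5, Thm. 2.5.2] -/
theorem multiplicity_gr_eq_of_multiplicity_eq [FiniteDimensional ℚ V] [FiniteDimensional ℚ V']
    (h : ∀ (U : Type u) [AddCommGroup U] [Module ℚ U] (S : MixedHodgeStructure U), S.IsSimple →
      H.multiplicity S = H'.multiplicity S)
    (k : ℤ) {U : Type u} [AddCommGroup U] [Module ℚ U] (S : MixedHodgeStructure U) (hS : S.IsSimple) :
    (H.gr k).toMixedHodgeStructure.multiplicity S = (H'.gr k).toMixedHodgeStructure.multiplicity S := by
  haveI := hS.nontrivial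
  obtain ⟨m, hm⟩ := hS.exists_isPure
  by_cases hkm : k = m
  · subst hkm
    rw [← multiplicity_eq_multiplicity_gr H hm, ← multiplicity_eq_multiplicity_gr H' hm]
    exact h U S hS
  · rw [multiplicity_gr_eq_zero_of_ne H hm hkm, multiplicity_gr_eq_zero_of_ne H' hm hkm]

/-- **For graded-polarizable `H`, `H'`: same multiplicities ⟹ isomorphic graded pieces** (the `Gr^W_k` are
semisimple — polarizable pure Hodge structures — with the same multiplicities). [cite: Jannsen1990MixedMotives, Thm. 7.9 (proof)]
[cite: AdkinsWeintraub1992, Ch. 7, §1, Thm. 1.18] [cite: CattaniElZeinGriffithsLe2014, Def. 3.2.15 and Thm. 3.2.18] -/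
theorem IsGradedPolarizable.forall_gr_iso_of_multiplicity_eq [FiniteDimensional ℚ V] [FiniteDimensional ℚ V']
    (hp : H.IsGradedPolarizable) (hp' : H'.IsGradedPolarizable)
    (h : ∀ (U : Type u) [AddCommGroup U] [Module ℚ U] (S : MixedHodgeStructure U), S.IsSimple →
      H.multiplicity S = H'.multiplicity S) (k : ℤ) :
    ∃ e : Hom (H.gr k).toMixedHodgeStructure (H'.gr k).toMixedHodgeStructure, Function.Bijective e.toLinearMap :=
  (hp.isSemisimple_gr k).exists_hom_bijective_of_multiplicity_eq (hp'.isSemisimple_gr k)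
    fun _ _ _ S hS => multiplicity_gr_eq_of_multiplicity_eq h k S hS

/-- **For graded-polarizable MHS, "same composition factors" means "isomorphic graded pieces"**:
`Gr^W_k H ≅ Gr^W_k H'` for all `k` iff `[H : S] = [H' : S]` for all simple `S` — the composition factors see the
pure polarizable Hodge structures `Gr^W_k H`, not the extensions between them. [cite: Jannsen1990MixedMotives, Thm. 7.9 (proof)]
[cite: AdkinsWeintraub1992, Ch. 7, §1, Thm. 1.18] [cite: CattaniElZeinGriffithsLe2014, Def. 3.2.15, Thm. 3.2.18 and Ex. 3.2.23 (1)] -/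
theorem IsGradedPolarizable.forall_gr_iso_iff_forall_multiplicity_eq [FiniteDimensional ℚ V] [FiniteDimensional ℚ V']
    (hp : H.IsGradedPolarizable) (hp' : H'.IsGradedPolarizable) :
    (∀ k, ∃ e : Hom (H.gr k).toMixedHodgeStructure (H'.gr k).toMixedHodgeStructure, Function.Bijective e.toLinearMap) ↔
      ∀ (U : Type u) [AddCommGroup U] [Module ℚ U] (S : MixedHodgeStructure U), S.IsSimple →
        H.multiplicity S = H'.multiplicity S :=
  ⟨fun hgr _ _ _ S _ => multiplicity_eq_of_forall_gr_iso hgr S, hp.forall_gr_iso_of_multiplicity_eq hp'⟩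

/-- **`ℚ`-split graded-polarizable MHS (= semisimple graded-polarizable MHS) are classified by their multiplicities.**
[cite: AdkinsWeintraub1992, Ch. 7, §1, Thm. 1.18] [cite: Jannsen1990MixedMotives, Thm. 7.9 (proof)]
[cite: CattaniElZeinGriffithsLe2014, Ch. 12 footnote 2 (p. 527)] -/
theorem IsSplitOverQ.exists_hom_bijective_of_multiplicity_eq [FiniteDimensional ℚ V] [FiniteDimensional ℚ V']
    (hs : H.IsSplitOverQ) (hp : H.IsGradedPolarizable) (hs' : H'.IsSplitOverQ) (hp' : H'.IsGradedPolarizable)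
    (h : ∀ (U : Type u) [AddCommGroup U] [Module ℚ U] (S : MixedHodgeStructure U), S.IsSimple →
      H.multiplicity S = H'.multiplicity S) :
    ∃ e : Hom H H', Function.Bijective e.toLinearMap :=
  (hs.isSemisimple hp).exists_hom_bijective_of_multiplicity_eq (hs'.isSemisimple hp') h

/-- **Polarizable pure Hodge structures are classified (as MHS) by their multiplicities**: two polarizable pure
Hodge structures containing every simple Hodge structure with the same multiplicity are isomorphic.
[cite: AdkinsWeintraub1992, Ch. 7, §1, Thm. 1.18] [cite: Jannsen1990MixedMotives, Thm. 7.9 (proof)] -/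
theorem _root_.Literature.AlgebraicGeometry.Motives.HodgeStructure.IsPolarizable.exists_hom_bijective_of_multiplicity_eq
    [FiniteDimensional ℚ V] [FiniteDimensional ℚ V'] {n n' : ℤ} {H₀ : HodgeStructure V n} {H₀' : HodgeStructure V' n'}
    (hH₀ : H₀.IsPolarizable) (hH₀' : H₀'.IsPolarizable)
    (h : ∀ (U : Type u) [AddCommGroup U] [Module ℚ U] (S : MixedHodgeStructure U), S.IsSimple →
      H₀.toMixedHodgeStructure.multiplicity S = H₀'.toMixedHodgeStructure.multiplicity S) :
    ∃ e : Hom H₀.toMixedHodgeStructure H₀'.toMixedHodgeStructure, Function.Bijective e.toLinearMap :=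
  hH₀.isSemisimple_toMixedHodgeStructure.exists_hom_bijective_of_multiplicity_eq hH₀'.isSemisimple_toMixedHodgeStructure h

end MixedHodgeStructure

end Literature.AlgebraicGeometry.Motives
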